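import Mathlib.Algebra.DualNumber
import Mathlib.Data.ZMod.Basic
import Summits.Ventures.DiscreteObjects.UnitDistance.UnitCircleGraph
import HarnessLib

/-!
# Second-order reduction at a ramified prime never improves on first order

Framing (verbatim for the cell): lottery ticket; floor = certified bounds/negative ranges.

Madore (arXiv:1509.07023, Prop. 3.5) bounds the chromatic number of the plane over a number field `K` by that of the
unit-circle Cayley graph over the finite ring `O/𝔭²` (finer, a priori, than the residue field `O/𝔭`).  When `𝔭` is a
RAMIFIED prime of residue degree one over `p` (the case of the prime over 11 in Heule's field `ℚ(√3,√5,√11)`), the ring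
`O/𝔭²` is the ring of dual numbers `𝔽_p[ε]/(ε²)`, which contains `𝔽_p` as a subring AND maps onto it; by functoriality of
`unitCircleGraph` (file `UnitCircleGraph.lean`) the two unit-circle graphs then have the SAME chromatic number, so the
second-order bound equals the first-order one.  (For an unramified degree-one prime `O/𝔭² = ℤ/p²` has characteristic `p²`
and admits no such section; there the question is genuinely computational — see the (U) census table TABLE-U3 §2, where
`p = 7, 11` are settled by certificate.)  Everything here is elementary; the content is the bookkeeping.
-/

namespace Summit.Ventures.DiscreteObjects.UnitDistance

open SimpleGraph

/-- If two nontrivial commutative rings admit ring homomorphisms in both directions, their unit-circle graphs have the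
same chromatic number (each maps homomorphically into the other). -/
theorem chromaticNumber_unitCircleGraph_eq_of_ringHom_pair {A B : Type*} [CommRing A] [CommRing B] [Nontrivial A]
    [Nontrivial B] (ι : A →+* B) (π : B →+* A) :
    (unitCircleGraph A).chromaticNumber = (unitCircleGraph B).chromaticNumber :=
  le_antisymm (chromaticNumber_mono_of_hom (unitCircleGraph.map ι))
    (chromaticNumber_mono_of_hom (unitCircleGraph.map π))

/-- Colourability version of `chromaticNumber_unitCircleGraph_eq_of_ringHom_pair`. -/
theorem colorable_unitCircleGraph_iff_of_ringHom_pair {A B : Type*} [CommRing A] [CommRing B] [Nontrivial A]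
    [Nontrivial B] (ι : A →+* B) (π : B →+* A) (n : ℕ) :
    (unitCircleGraph A).Colorable n ↔ (unitCircleGraph B).Colorable n :=
  ⟨fun h => h.of_hom (unitCircleGraph.map π), fun h => h.of_hom (unitCircleGraph.map ι)⟩

/-- SECOND ORDER = FIRST ORDER AT A RAMIFIED DEGREE-ONE PRIME.  For every nontrivial commutative ring `R`, the unit-circle
graph over the dual numbers `R[ε]/(ε²)` has the same chromatic number as the one over `R`: the inclusion `R → R[ε]` and the
augmentation `R[ε] → R` are ring homomorphisms.  With `R = ZMod p` and `𝔭` ramified of residue degree one, `O/𝔭² ≅ R[ε]`. -/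
theorem chromaticNumber_unitCircleGraph_dualNumber (R : Type*) [CommRing R] [Nontrivial R] :
    (unitCircleGraph (DualNumber R)).chromaticNumber = (unitCircleGraph R).chromaticNumber :=
  (chromaticNumber_unitCircleGraph_eq_of_ringHom_pair (TrivSqZeroExt.inlHom R R)
    (TrivSqZeroExt.fstHom R R R).toRingHom).symm

/-- Colourability version: `unitCircleGraph (R[ε])` is `n`-colourable iff `unitCircleGraph R` is. -/
theorem colorable_unitCircleGraph_dualNumber_iff (R : Type*) [CommRing R] [Nontrivial R] (n : ℕ) :
    (unitCircleGraph (DualNumber R)).Colorable n ↔ (unitCircleGraph R).Colorable n :=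
  (colorable_unitCircleGraph_iff_of_ringHom_pair (TrivSqZeroExt.inlHom R R)
    (TrivSqZeroExt.fstHom R R R).toRingHom n).symm

/-- The census instance: at the (ramified, degree-one) prime over 11 of Heule's field the second-order graph
`unitCircleGraph (𝔽₁₁[ε])` has the same chromatic number as the 121-vertex graph `unitCircleGraph (ZMod 11)`
(which is 5, `FiniteFieldObstruction.lean` gives `≤ 5` by kernel computation). -/
theorem chromaticNumber_unitCircleGraph_dualNumber_zmod11 :
    (unitCircleGraph (DualNumber (ZMod 11))).chromaticNumber = (unitCircleGraph (ZMod 11)).chromaticNumber :=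
  haveI : Fact (1 < 11) := ⟨by norm_num⟩
  chromaticNumber_unitCircleGraph_dualNumber (ZMod 11)

end Summit.Ventures.DiscreteObjects.UnitDistance
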